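import Literature.Computability.Complexity.ExpClosure
import Literature.Computability.Complexity.Nondeterministic
import HarnessLib

/-!
# Collapses to deterministic exponential time close the nondeterministic classes under complement:
# `E = NE ⟹ NE = coNE`, `EXP = NEXP ⟹ NEXP = coNEXP`

Literature / complexity toolkit (problem `PneNP`; bookkeeping between the hypotheses of the two
Krajíček–Pudlák theorems in the tree — `E = NE ⟹` p-optimal proof system
(`KrajicekPudlak1989_pOptimalTaut_of_E_eq_NE_holds`) and `co NE = NE ⟹` optimal proof system
(`exists_optimal_of_co_NE_eq_NE`) — and the separations above `NP ≠ coNP`: `NE ≠ coNE ⟹ E ≠ NE`,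
`NEXP ≠ coNEXP ⟹ EXP ≠ NEXP`). Deterministic time classes are closed under complement
(`compl_mem_DTIME_iff`, `compl_mem_EXP_iff`), so a collapse of the nondeterministic class onto the
deterministic one transports that closure. All proved; no named fact, no definition.

## References

* S. Arora, B. Barak, *Computational Complexity: A Modern Approach*, CUP 2009, §2.6.1 (coNP and
  complement classes; deterministic classes are closed under complement), §2.6.2 (`EXP`, `NEXP`)
  [AroraBarak2009].
* J. Krajíček, *Proof complexity*, CUP 2019, Cor. 21.1.3 (the hypotheses `NE ≠ coNE`, `E ≠ NE`)
  [KrajicekProofComplexity2019].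
-/

namespace Literature.Computability.Complexity

/-- **`co E = E`**: deterministic linear-exponential time is closed under complement.
[cite: AroraBarak2009, §2.6.1 (deterministic classes are closed under complement)] -/
theorem co_E_eq_E : co E = E :=
  co_eq_self_of_compl_mem_iff fun L => by simp only [E, Set.mem_iUnion, compl_mem_DTIME_iff]

/-- **`E = NE ⟹ NE = coNE`** (in the tree's notation `co NE = NE`).
[cite: AroraBarak2009, §2.6.1] [cite: KrajicekProofComplexity2019, Cor. 21.1.3] -/
theorem co_NE_eq_NE_of_E_eq_NE (h : E = NE) : co NE = NE := by
  rw [← h]; exact co_E_eq_E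

/-- **`NE ≠ coNE ⟹ E ≠ NE`** (so the hypothesis of Krajíček 2019, Cor. 21.1.3's conclusion for
optimal proof systems implies the one for p-optimal systems). [cite: KrajicekProofComplexity2019, Cor. 21.1.3] -/
theorem E_ne_NE_of_co_NE_ne_NE (h : co NE ≠ NE) : E ≠ NE :=
  fun hc => h (co_NE_eq_NE_of_E_eq_NE hc)

/-- **`EXP = NEXP ⟹ NEXP = coNEXP`** (in the tree's notation `co NEXP = NEXP`).
[cite: AroraBarak2009, §2.6.1 and §2.6.2] -/
theorem co_NEXP_eq_NEXP_of_EXP_eq_NEXP (h : EXP = NEXP) : co NEXP = NEXP := by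
  rw [← h]; exact co_eq_self_of_compl_mem_iff fun _ => compl_mem_EXP_iff

/-- **`NEXP ≠ coNEXP ⟹ EXP ≠ NEXP`.** [cite: AroraBarak2009, §2.6.2] -/
theorem EXP_ne_NEXP_of_co_NEXP_ne_NEXP (h : co NEXP ≠ NEXP) : EXP ≠ NEXP :=
  fun hc => h (co_NEXP_eq_NEXP_of_EXP_eq_NEXP hc)

end Literature.Computability.Complexity
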